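import Summits.HodgeConjecture.CorCM.DecicWeil23TripleFrameTransfer
import Summits.HodgeConjecture.CorCM.DecicWeil23PairTenfoldParts
import HarnessLib

/-!
# COR-CM — three `(2,3)`-types over one decic CM field: the TENFOLD part `{(m₁,a,+)} ⊔ {(m₂,a,−)}` of a weight of any product
# of copies of `E, B₁, B₂, B₃` has an algebraic line, GIVEN the sixfold parts of the product with TWO MORE CURVES (push-pull)

Cell `pub-hodgecm2` (COR-CM), seat b30 gen 22 (2026-08-22); count-neutral own lane DECIC-WEIL-23PAIR, part TRIPLE.
Theorems + one bookkeeping definition (`extT₂`, two fresh curve slots in front of a four-atom slot map); no named fact, no `sorry`.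
The three-slot twin of `CorCM/DecicWeil23PairTenfoldParts` (same proof, slots `(m₁, m₂)` in place of `(0, 1)`), a consumer of
`CMWeights.weightClassesAlg_le_algebraicClasses_of_pushforward` (`CorCM/CMWeightPushforwardExtraction.lean`).

THE ARGUMENT.  Let `X = ⨁_j A₄(κ j)` and let `G` be a tenfold part of a weight of `X`: one point over each label `(m₁, a, +)`
(the five embeddings over `τ` on copies of `B_{m₁}`) and one over each `(m₂, a, −)` (over `τ̄`, on copies of `B_{m₂}`) — the Weil
weight of the tenfold `B_{m₁} × B̄_{m₂}` (`k`-signature `(5,5)`), which is `E`-free and therefore NOT a disjoint union of sixfold parts and pairs.  Put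
two curves in front: `X⁺ = E ⊞ E ⊞ X = ⨁_l A₄(extT₂ κ l)`, `X` being the coordinate sub-product `e₂ j = j + 2`.  On `X⁺`, with
`T = {(0, τ), (1, τ̄)}`, `σ_{e₂} G ⊔ T = (σ G₀ ⊔ {(0, τ)}) ⊔ (σ G₁ ⊔ {(1, τ̄)})` is a disjoint union of a SIXFOLD part of
slot `m₁`, sign `+` (the Weil weight of `B_{m₁} × E`) and a SIXFOLD part of slot `m₂`, sign `−` (that of `B̄_{m₂} × Ē`) — hypothesis `hsix`: their lines are algebraic, discharged downstream from Markman's sixfold theorem — and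
the complementary weight `T' = {(0, τ̄), (1, τ)}` is ONE conjugate pair of curve coordinates (a divisor line,
`weightClassesAlg_le_algebraicClasses_of_isPairPartT`).  The push-forward extraction lemma then gives the line of `G` on `X`
(codimension `5`).

* §1 `extT₂ κ = (0, 0, κ)` (`Fin.cons`, so that `extT₂ κ (j+2)` is DEFINITIONALLY `κ j`);
* §2 **`weightClassesAlg_le_algebraicClasses_of_isTenPartT`** — THE LEMMA.
HONEST FRAMING: nothing about the Hodge conjecture is concluded in this file; `HC_CM` is not asserted.
[cite: Schoen1998HodgeWeilAddendum, §10] [cite: Milne2020HodgeClassesAV, 1.2 (a) and Thm. 1] [cite: MoonenZarhin1995Duke, Thm. 2.4]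

## References
* [Schoen1998HodgeWeilAddendum] C. Schoen, Compositio Math. 114 (1998), §10.  [Milne2020HodgeClassesAV] J. S. Milne,
  arXiv:2010.08857, 1.2 (a), Thm. 1.  [MoonenZarhin1995Duke] B. Moonen, Yu. Zarhin, Duke Math. J. 77 (1995), Thm. 2.4.
  [Gordon1999HodgeAVSurvey] B. B. Gordon, CRM Monogr. 10 (1999), 9.2.2.
-/

noncomputable section

open CategoryTheory CategoryTheory.Limits NumberField

namespace Summit.HodgeConjecture.CorCM.DecicWeil23Triple

open Literature.AlgebraicGeometry Literature.AlgebraicGeometry.Motives Literature.AlgebraicGeometry.HodgeTheory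
open Literature.AlgebraicGeometry.ComplexMultiplication (IsCMTypeRealisation)
open Literature.AlgebraicGeometry.Pohlmann1968
open Literature.NumberTheory.ComplexMultiplication
open Summit.HodgeConjecture.CorCM.Census.DecicWeil23Triple (PtT cjT cjT_inl cjT_facts IsPairPartT IsFivePartT IsSixPartT
  IsTenPartT)
open Summit.HodgeConjecture.CorCM.DecicWeil23Pair (succ₂_injective eq_of_not_mem_range_succ₂ not_mem_range_succ₂)
open Summit.HodgeConjecture.CorCM.OcticWeilOrbit (orbitSlots)
open Summit.HodgeConjecture.CorCM.CMWeights (weightClassesAlg_le_algebraicClasses_of_pushforward sigma_map_injective)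
open Summit.HodgeConjecture.CorCM.PairWeights (weightClassesAlg_union_le_algebraicClasses)
open Summit.HodgeConjecture.CorCM.OcticWeil13Pair (decide_tauSign_eq exists_eq_tauSign tauSign_not_ne)

open scoped Classical

/-! ## §1 Two fresh curve slots in front -/

/-- **Two fresh curve slots in front of a slot map** (four atoms): `extT₂ κ = (0, 0, κ)` as an iterated `Fin.cons`, so that
`extT₂ κ j.succ.succ` is DEFINITIONALLY `κ j` and `extT₂ κ 0`, `extT₂ κ 1` are DEFINITIONALLY the curve slot `0` (the four-atom
twin of `DecicWeil23Pair.ext₂`; `succ₂_injective` etc. are reused from that file). [folklore] -/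
def extT₂ {N : ℕ} (κ : Fin N → Fin 4) : Fin (N + 2) → Fin 4 :=
  Fin.cons 0 (Fin.cons 0 κ : Fin (N + 1) → Fin 4)

/-- The embedding of the old slots: `e₂ j = j + 2`. [folklore] -/
theorem extT₂_succ {N : ℕ} (κ : Fin N → Fin 4) (j : Fin N) : extT₂ κ j.succ.succ = κ j := rfl

section Tenfold

variable {I : Type} {Kf : I → Type} [∀ i, Field (Kf i)] [∀ i, NumberField (Kf i)] [∀ i, IsCMField (Kf i)]
  {i₀ i₁ : I} {N : ℕ} (κ : Fin N → Fin 4) {e : (Kf i₁ →+* ℂ) ≃ Fin 5 × Bool} {τ : Kf i₀ →+* ℂ}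
  (hττ : ComplexEmbedding.conjugate τ ≠ τ) (hk : ∀ σ : Kf i₀ →+* ℂ, σ = τ ∨ σ = ComplexEmbedding.conjugate τ)
  (he_conj : ∀ s : Kf i₁ →+* ℂ, e (ComplexEmbedding.conjugate s) = ((e s).1, !(e s).2))
  {A₄ : Fin 4 → AbelianVariety ℂ} {Φ₄ : ∀ j : Fin 4, CMType (Kf (orbitSlots i₀ i₁ j))}
  {ι₄ : ∀ j, 𝓞 (Kf (orbitSlots i₀ i₁ j)) →+* End (A₄ j)}
  {θ₄ : ∀ j, Kf (orbitSlots i₀ i₁ j) →+* Module.End ℂ (complexBetti (A₄ j).X 1)}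
  (hA : ∀ j, IsCMTypeRealisation (Φ₄ j) (A₄ j) (ι₄ j) (θ₄ j))

/-! The fresh curve coordinates `τ_c` (`τ_true = τ`, `τ_false = τ̄`) are read in the model by gen 21's
`OcticWeil13Pair.decide_tauSign_eq` / `exists_eq_tauSign` / `tauSign_not_ne` (imported BY NAME). -/

/-! ## §2 The tenfold part has an algebraic line, given the sixfold parts of `X⁺` -/

include hττ hk he_conj hA in
/-- **THE TENFOLD PART LEMMA.**  Let `X = ⨁_j A₄(κ j)` be a product of copies of `E, B₁, B₂` and `G` a tenfold part of a weight of
`X` (one point over each `(m₁, a, +)` and each `(m₂, a, −)`).  IF on `X⁺ = E ⊞ E ⊞ X = ⨁_l A₄(extT₂ κ l)` every sixfold part has an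
algebraic line (`hsix`), THEN the line of `G` on `X` is algebraic (codimension `5`): push-pull through the two fresh curves (module
docstring; `CMWeights.weightClassesAlg_le_algebraicClasses_of_pushforward`).
[cite: Schoen1998HodgeWeilAddendum, §10] [cite: Milne2020HodgeClassesAV, 1.2 (a) and Thm. 1] [cite: MoonenZarhin1995Duke, Thm. 2.4] -/
theorem weightClassesAlg_le_algebraicClasses_of_isTenPartT
    (hsix : ∀ (m : Fin 3) (c : Bool) (G' : Finset ((l : Fin (N + 2)) × (Kf (orbitSlots i₀ i₁ (extT₂ κ l)) →+* ℂ))),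
      IsSixPartT (fun x => toPtT e τ ((Sigma.map (extT₂ κ) (fun _ => id) :
        ((l : Fin (N + 2)) × (Kf (orbitSlots i₀ i₁ (extT₂ κ l)) →+* ℂ)) → ((m : Fin 4) × (Kf (orbitSlots i₀ i₁ m) →+* ℂ))) x))
          m c G' →
        weightClassesAlg (fun l => A₄ (extT₂ κ l)) (fun l => ι₄ (extT₂ κ l)) (2 * 3) G' ≤
          algebraicClasses (⨁ fun l => A₄ (extT₂ κ l)).X 3)
    {m₁ m₂ : Fin 3} {G : Finset ((j : Fin N) × (Kf (orbitSlots i₀ i₁ (κ j)) →+* ℂ))}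
    (hG : IsTenPartT (fun x => toPtT e τ ((Sigma.map κ (fun _ => id) :
      ((j : Fin N) × (Kf (orbitSlots i₀ i₁ (κ j)) →+* ℂ)) → ((m : Fin 4) × (Kf (orbitSlots i₀ i₁ m) →+* ℂ))) x)) m₁ m₂ G) :
    G.card = 2 * 5 ∧ weightClassesAlg (fun j => A₄ (κ j)) (fun j => ι₄ (κ j)) (2 * 5) G ≤
      algebraicClasses (⨁ fun j => A₄ (κ j)).X 5 := by
  have hGcard : G.card = 2 * 5 := by rw [hG.1]
  refine ⟨hGcard, ?_⟩
  -- ### notation: the two index sets, the model maps, the embedding `e₂`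
  let IX := (j : Fin N) × (Kf (orbitSlots i₀ i₁ (κ j)) →+* ℂ)
  let IP := (l : Fin (N + 2)) × (Kf (orbitSlots i₀ i₁ (extT₂ κ l)) →+* ℂ)
  let v : IX → PtT := fun x => toPtT e τ ((Sigma.map κ (fun _ => id) :
    IX → ((m : Fin 4) × (Kf (orbitSlots i₀ i₁ m) →+* ℂ))) x)
  let vP : IP → PtT := fun x => toPtT e τ ((Sigma.map (extT₂ κ) (fun _ => id) :
    IP → ((m : Fin 4) × (Kf (orbitSlots i₀ i₁ m) →+* ℂ))) x)
  let e₂ : Fin N → Fin (N + 2) := fun j => j.succ.succ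
  have he₂ : Function.Injective e₂ := succ₂_injective
  let σ₂ : IX ↪ IP := ⟨_, sigma_map_injective (K := fun l => Kf (orbitSlots i₀ i₁ (extT₂ κ l))) e₂ he₂⟩
  have hvσ : ∀ x : IX, vP (σ₂ x) = v x := fun x => rfl
  have hσfst : ∀ x : IX, 2 ≤ ((σ₂ x).1 : ℕ) := fun x => by
    change 2 ≤ ((x.1.succ.succ : Fin (N + 2)) : ℕ)
    simp only [Fin.val_succ]; omega
  have hAP : ∀ l, IsCMTypeRealisation (Φ₄ (extT₂ κ l)) (A₄ (extT₂ κ l)) (ι₄ (extT₂ κ l)) (θ₄ (extT₂ κ l)) :=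
    fun l => hA (extT₂ κ l)
  -- ### the fresh curve coordinates
  let τs : Bool → (Kf i₀ →+* ℂ) := fun c => if c then τ else ComplexEmbedding.conjugate τ
  have hτs : ∀ c, decide (τs c = τ) = c := fun c => decide_tauSign_eq hττ c
  have hτs_ne : ∀ c, τs (!c) ≠ τs c := fun c => tauSign_not_ne hττ c
  let p0 : Bool → IP := fun c => ⟨0, τs c⟩
  let p1 : Bool → IP := fun c => ⟨1, τs c⟩
  have hv0 : ∀ c, vP (p0 c) = Sum.inl c := fun c => by
    change toPtT e τ ⟨0, τs c⟩ = _; rw [toPtT_zero, hτs]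
  have hv1 : ∀ c, vP (p1 c) = Sum.inl c := fun c => by
    change toPtT e τ ⟨0, τs c⟩ = _; rw [toPtT_zero, hτs]
  have hfst0 : ∀ c, ((p0 c).1 : ℕ) = 0 := fun c => rfl
  have hfst1 : ∀ c, ((p1 c).1 : ℕ) = 1 := fun c => rfl
  -- every coordinate of a fresh slot is one of the four points
  have hfresh : ∀ x : IP, x.1 ∉ Set.range e₂ → ∃ c, x = p0 c ∨ x = p1 c := by
    rintro ⟨l, σ⟩ hl
    rcases eq_of_not_mem_range_succ₂ hl with rfl | rfl
    · obtain ⟨c, hc⟩ := exists_eq_tauSign hk σ; exact ⟨c, Or.inl (by rw [hc])⟩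
    · obtain ⟨c, hc⟩ := exists_eq_tauSign hk σ; exact ⟨c, Or.inr (by rw [hc])⟩
  -- ### the weights `T = {p0 +, p1 −}` and `T' = {p0 −, p1 +}` (`b = true`)
  let b : Bool := true
  have hne01 : ∀ c c', p0 c ≠ p1 c' := fun c c' h => by
    have := congrArg (fun x : IP => (x.1 : ℕ)) h; simp [hfst0, hfst1] at this
  have hne00 : p0 (!b) ≠ p0 b := fun h => hτs_ne b (eq_of_heq (Sigma.mk.inj_iff.1 h).2)
  have hne11 : p1 (!b) ≠ p1 b := fun h => hτs_ne b (eq_of_heq (Sigma.mk.inj_iff.1 h).2)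
  set T : Finset IP := {p0 b, p1 (!b)} with hT
  set T' : Finset IP := {p0 (!b), p1 b} with hT'
  have hTcard : T.card = 2 * 1 := Finset.card_pair (hne01 b (!b))
  have hT'card : T'.card = 2 * 1 := Finset.card_pair (hne01 (!b) b)
  have hmemT : ∀ x, x ∈ T ↔ x = p0 b ∨ x = p1 (!b) := fun x => by
    simp only [hT, Finset.mem_insert, Finset.mem_singleton]
  have hmemT' : ∀ x, x ∈ T' ↔ x = p0 (!b) ∨ x = p1 b := fun x => by
    simp only [hT', Finset.mem_insert, Finset.mem_singleton]
  have hTT' : Disjoint T T' := by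
    rw [Finset.disjoint_left]
    intro x hx hx'
    rw [hmemT] at hx
    rw [hmemT'] at hx'
    rcases hx with rfl | rfl <;> rcases hx' with h | h
    exacts [hne00 h.symm, hne01 _ _ h, (hne01 _ _ h.symm).elim, hne11 h]
  -- `T ⊔ T'` = all coordinates off the old slots
  have hfreshT : ∀ x : IP, (x ∈ T ∨ x ∈ T') → x.1 ∉ Set.range e₂ := by
    intro x hx
    apply not_mem_range_succ₂
    rcases hx with hx | hx
    · rw [hmemT] at hx
      rcases hx with rfl | rfl
      · rw [hfst0]; norm_num
      · rw [hfst1]; norm_num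
    · rw [hmemT'] at hx
      rcases hx with rfl | rfl
      · rw [hfst0]; norm_num
      · rw [hfst1]; norm_num
  have hcov : ∀ x : IP, (x ∈ T ∨ x ∈ T') ↔ x.1 ∉ Set.range e₂ := by
    intro x
    refine ⟨hfreshT x, fun hx => ?_⟩
    obtain ⟨c, hc⟩ := hfresh x hx
    rw [hmemT, hmemT']
    cases c
    · rcases hc with h | h
      · exact Or.inr (Or.inl h)
      · exact Or.inl (Or.inr h)
    · rcases hc with h | h
      · exact Or.inl (Or.inl h)
      · exact Or.inr (Or.inr h)
  -- ### `T'` is one conjugate pair of curve coordinates: algebraic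
  have halg₂ : weightClassesAlg (fun l => A₄ (extT₂ κ l)) (fun l => ι₄ (extT₂ κ l)) (2 * 1) T' ≤
      algebraicClasses (⨁ fun l => A₄ (extT₂ κ l)).X 1 := by
    refine (weightClassesAlg_le_algebraicClasses_of_isPairPartT (extT₂ κ) hττ hk he_conj hA ⟨Sum.inl (!b),
      hT'card, ?_, ?_⟩).2
    · intro z hz z' hz' h
      simp only [hT', Finset.coe_insert, Finset.coe_singleton, Set.mem_insert_iff, Set.mem_singleton_iff] at hz hz'
      rcases hz with rfl | rfl <;> rcases hz' with rfl | rfl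
      · rfl
      · exact absurd ((hv0 (!b)).symm.trans (h.trans (hv1 b))) (by cases b <;> simp)
      · exact absurd ((hv1 b).symm.trans (h.trans (hv0 (!b)))) (by cases b <;> simp)
      · rfl
    · rw [hT', Finset.image_insert, Finset.image_singleton, cjT_inl, Bool.not_not]
      change ({vP (p0 (!b)), vP (p1 b)} : Finset PtT) = _
      rw [hv0, hv1]
  -- ### `σ G ⊔ T` is two sixfold parts: algebraic
  obtain ⟨G₀, G₁, hG₀₁, hGU, hW₀, hW₁⟩ := hG.exists_split
  have hsixpart : ∀ (m : Fin 3) (c : Bool) (W : Finset IX) (x : IP), IsFivePartT v m c W → vP x = Sum.inl c →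
      ((x.1 : ℕ) < 2) → Disjoint (W.map σ₂) {x} ∧ IsSixPartT vP m c (W.map σ₂ ∪ {x}) := by
    intro m c W x hW hx hx2
    have hdisj : Disjoint (W.map σ₂) {x} := by
      rw [Finset.disjoint_singleton_right]
      intro hz
      obtain ⟨w, -, hw⟩ := Finset.mem_map.1 hz
      have h2 := hσfst w
      rw [hw] at h2; omega
    refine ⟨hdisj, ?_, ?_, fun a => ?_⟩
    · rw [Finset.card_union_of_disjoint hdisj, Finset.card_map, hW.1, Finset.card_singleton]
    · have hF : ∀ z ∈ W.map σ₂, ¬ vP z = Sum.inl c := fun z hz => by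
        obtain ⟨w, hw, rfl⟩ := Finset.mem_map.1 hz
        obtain ⟨a, ha⟩ := hW.exists_eq_inr hw
        change vP (σ₂ w) ≠ _
        rw [hvσ, show v w = Sum.inr (m, (a, c)) from ha]
        exact Sum.inr_ne_inl
      rw [Finset.filter_union, Finset.filter_false_of_mem hF, Finset.empty_union,
        Finset.filter_true_of_mem (fun z hz => by rw [Finset.mem_singleton.1 hz]; exact hx), Finset.card_singleton]
    · have hF : ∀ z ∈ ({x} : Finset IP), ¬ vP z = Sum.inr (m, (a, c)) := fun z hz => by
        rw [Finset.mem_singleton.1 hz, show vP x = _ from hx]; exact Sum.inl_ne_inr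
      rw [Finset.filter_union, Finset.filter_false_of_mem hF, Finset.union_empty, Finset.filter_map, Finset.card_map,
        ← hW.2 a]
      exact congrArg Finset.card (Finset.filter_congr fun w _ => by rw [Function.comp_apply, hvσ])
  obtain ⟨hd₀, hS₀⟩ := hsixpart m₁ b G₀ (p0 b) hW₀ (hv0 _) (by rw [hfst0]; norm_num)
  obtain ⟨hd₁, hS₁⟩ := hsixpart m₂ (!b) G₁ (p1 (!b)) hW₁ (hv1 _) (by rw [hfst1]; norm_num)
  have hS₀₁ : Disjoint (G₀.map σ₂ ∪ {p0 b}) (G₁.map σ₂ ∪ {p1 (!b)}) := by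
    rw [Finset.disjoint_union_left, Finset.disjoint_union_right, Finset.disjoint_union_right]
    refine ⟨⟨(Finset.disjoint_map σ₂).2 hG₀₁, ?_⟩, ?_, Finset.disjoint_singleton.2 (hne01 b (!b))⟩
    · rw [Finset.disjoint_singleton_right]
      intro hz
      obtain ⟨w, -, hw⟩ := Finset.mem_map.1 hz
      have h2 := hσfst w
      rw [hw, hfst1] at h2; omega
    · rw [Finset.disjoint_singleton_left]
      intro hz
      obtain ⟨w, -, hw⟩ := Finset.mem_map.1 hz
      have h2 := hσfst w
      rw [hw, hfst0] at h2; omega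
  have hunion : G.map σ₂ ∪ T = (G₀.map σ₂ ∪ {p0 b}).disjUnion (G₁.map σ₂ ∪ {p1 (!b)}) hS₀₁ := by
    rw [Finset.disjUnion_eq_union, hGU, Finset.map_union, hT, Finset.union_union_union_comm]
    rfl
  have halg₁ : weightClassesAlg (fun l => A₄ (extT₂ κ l)) (fun l => ι₄ (extT₂ κ l)) (2 * (5 + 1)) (G.map σ₂ ∪ T) ≤
      algebraicClasses (⨁ fun l => A₄ (extT₂ κ l)).X (5 + 1) := by
    rw [hunion]
    exact weightClassesAlg_union_le_algebraicClasses hAP (a := 3) (b := 3) (p := 5 + 1) rfl hS₀.1 hS₁.1 hS₀₁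
      (hsix m₁ b _ hS₀) (hsix m₂ (!b) _ hS₁)
  -- ### push-pull
  exact weightClassesAlg_le_algebraicClasses_of_pushforward (A := fun l => A₄ (extT₂ κ l))
    (Φ := fun l => Φ₄ (extT₂ κ l)) (ι := fun l => ι₄ (extT₂ κ l)) (θ := fun l => θ₄ (extT₂ κ l)) hAP e₂ he₂
    (p := 5) (q := 1) (r := 1) hGcard hTcard hT'card hTT' hcov halg₁ halg₂

end Tenfold

end Summit.HodgeConjecture.CorCM.DecicWeil23Triple

end
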